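/-
Copyright: statement-level skeleton of a published paper (lit-balaban cell, Phase-2 proof seat p25, gen 15). No proof
claims beyond what the kernel checks below.
-/
import Literature.MathematicalPhysics.QuantumFieldTheory.BalabanImbrieJaffe1984to88.BIJ88VertexIbp311

/-!
# `BalabanImbrieJaffe1984to88.BIJ88VertexExpansion311` — T. Bałaban, J. Imbrie, A. Jaffe, *Effective action and
cluster properties of the abelian Higgs model*, Commun. Math. Phys. **114** (1988) 257–315 [BalabanImbrieJaffe1988],
§5.14 p. 311–312 [PDF 55–56] *"those fields can be contracted via covariances … to other observables, to χ′_{Λ^{(k)}},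
or to the interaction. … A connected component of X is called complete if a contraction to χ′_{Λ^{(k)}} occurs, if a
term from the random walk expansion occurs, if at least m̄+1 interactions have been differentiated down, or if the term
is constant (all legs contracted). We stop integrating by parts fields in complete components of X. After sufficiently
many integrations by parts, all components of X will be complete. … Summing all possible diagrams in X_c gives the
observable for the next step there, F^L_{k+1,loc}(X_c). Summing all terms in X_r gives an observable F_{k,rem}(X_r). Then
the result of the integration by parts is ⟨Π_{σ_i}F^{m̄}_{k,loc}(X_{σ_i})⟩ = Σ_{{X_r}} Π_c F^L_{k+1,loc}(X_c)
⟨Π_r F_{k,rem}(X_r)⟩"* — **THE INTEGRATION BY PARTS CONTINUED THROUGH THE LEGS OF THE DIFFERENTIATED-DOWN VERTICES,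
WITH PRINT'S STOPPING RULE, FOR ONE COMPONENT**: the expansion is DEFINED (`terms`, well-founded on (budget, number of
pending legs)), every term is CLASSIFIED by the printed reason it is terminal (`Kind`: `const` = all legs contracted /
`dchi` = a contraction to `χ′` / `cap` = the `(m̄+1)`-th vertex) with its vertex count (`terms_sound`: constant and
`χ′`-terms carry `≤ m̄` vertices, `cap` terms exactly `m̄+1`), the IDENTITY holds (`expansion`: nothing is lost), and the
p. 312 display follows for one component (`expansion_display`): in the expectation carrying the weight `χe^{−V}`,

  `⟨Π_LΦ⟩ = F^L + Σ_{remainder terms t} coef_t·⟨Π_{pend t}Φ · (χ′ or χ)/χ⟩`,   `F^L = cst` = the sum of ALL complete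
  contraction diagrams of the legs with AT MOST `m̄` interaction vertices differentiated down and no `χ′`

— r16's reading (b′) of row C2.Claim@312 (*"print's «diagrams» in X_c INCLUDE up to m̄ differentiated-down interaction
vertices … F^L_{k+1,loc}(X_c) = the observable renormalized by the interaction"*) made literal: gen 14's
`BIJ88IbpComponents312.wickSum`/`F^L` was the zeroth order of this `cst` in the interaction.

statement-level skeleton of published theorems with citation tags; proofs where landed; nothing here is a claim
about the Yang–Mills mass gap

PDF held: `paper:balaban1988-cmp114-bij-abelian-higgs-effective-action` (journal page = PDF page + 256); p. 311–312 =
PDF 55–56 (`p0055.txt` L31–45, `p0056.txt` L1–8 re-read this session).  Mechanism: Glimm–Jaffe, *Quantum Physics* (2nd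
ed.) §8.4 (8.4.2) *"Multiple applications of (8.4.2) give a series in powers of V … The second term in (8.4.2) adds a new
vertex (with one leg paired to the leg of φ)"* and §9.1 (9.1.32) [GlimmJaffe1987] (held, re-read this session).

CITATION HEADER (lean-in-tree rule).  lit-balaban cell (HOME `run/shared/lean/pub/lit-balaban/`), Phase 2, seat p25
gen 15 (free target, protocol G.5-34(d), TAKING line HOME/STATUS.md 2026-08-22T10:38Z).  Row **C2.Claim@312** of
`HOME/lit-balaban-r16/ROWS-C2-part2.md` (owner r16, referee ref-5; head untouched — the head is the ESTIMATE `Ineq312`):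
item **(β)** of the owner's recorded flip path (seat INBOX 2026-08-22T09:35Z).  USED BY NAME, nothing restated: the
sibling `BIJ88VertexIbp311` (same seat and generation: `lmono`, `vpoly`, `vexp`, `dpoly`, `ibp_step`),
`B2Eq228Conditioning.{weight, source}`.

## What is proved (0 `sorry`, standard axioms, no new `Prop` facts; definitions with bodies: `Kind`, `Term`,
`Term.scale`, `Term.bump`, `terms`, `kfac`, `tint`, `cst`, `remv`; theorems otherwise)

* §3 `Kind`, `Term` (coefficient = product of the contraction weights along the history, pending legs, kind, vertex
  count), **`terms A ℱ c legs L b`** — THE EXPANSION with remaining vertex budget `b` (`b = m̄ −` vertices so far):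
  the head field is integrated by parts (`ibp_step`); to another pending leg / to the source ⇒ continue; *"to χ′"* ⇒
  TERMINAL (`dchi`); to a vertex ⇒ its other legs are appended and the expansion continues with budget `b−1`, unless
  `b = 0` (the `(m̄+1)`-th vertex) ⇒ TERMINAL (`cap`); no pending leg ⇒ TERMINAL (`const`).  **`terms_sound`**: a
  `const` term has no pending leg; a `cap` term has exactly `b+1` vertices; every other term at most `b`.
* §4 `kfac`/`tint` (the value of a term: `coef · ∫ Π_{pend}Φ·(χ | ∂_zχ)·e^{−V}dμ`), **`expansion`** — THE IDENTITY
  `∫Π_LΦ·χe^{−V}dμ = Σ_{t ∈ terms L b} tint t` for every `L`, `b` (well-founded induction along the expansion, `ibp_step`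
  at each node); `cst` (= `F^L`) and `remv`; **`expansion_split`** `∫Π_LΦ·χe^{−V}dμ = F^L·∫χe^{−V}dμ + Σ_{rem}`;
  **`expansion_display`** (the p. 312 display for one component, normalized by `∫χe^{−V}dμ`);
  `bounds_of_hasCompactSupport` (the two boundedness hypotheses hold for every compactly supported `C¹` cutoff).
* §5 **`coef_bound`** — THE SMALL FACTOR PER VERTEX (p. 312 *"we have arranged for enough small factors to beat these
  large factors in the remainder terms"*): with all covariance brackets between the directions in play bounded by `B`
  and `|c_m| ≤ c_M`, every term has `|coef| ≤ (max B 1)^{|L|+1+b·D}·c_M^{nv}`; a `cap` term thus carries `c_M^{m̄+1}`.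
HONEST SCOPE.  (a) ONE COMPONENT: print's stopping rule is applied per CONNECTED COMPONENT of `X` (the cubes covering
the observables and the random-walk regions; components complete independently and the result factorizes over them,
`{X_c}` *"determined once the remainder components are specified"*); here the rule is global — the legs `L` form one
component, which is print's rule verbatim when `X` is connected, and otherwise stops some components earlier than print
would (a `χ′`-hit or the `(m̄+1)`-th vertex anywhere ends the whole term); the product structure over components (gen 14's
`BIJ88IbpComponents312`/`BIJ88ConnectedDiagrams312` for the vacuum case) is not combined with the vertices here.  (b) One
covariance `C = A⁻¹`: no `C_loc`/random-walk split, so print's third completeness trigger does not occur.  (c) The order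
of integrations by parts is fixed (head leg first, vertex legs appended at the end); print leaves the order free.  (d)
No estimates beyond the per-vertex coefficient count of §5 (`|G_k(X)|`, the small factor of a `χ′`-term from the
support of `χ′`, the combinatorial growth of the number of terms are not here): the head `Ineq312` of the row is
untouched.  NOT summit
progress; NOT continuum; NOT Clay.  Imports `BIJ88VertexIbp311` only; modifies nothing.
-/

noncomputable section

namespace Literature.MathematicalPhysics.QuantumFieldTheory.BalabanImbrieJaffe1984to88.BIJ88VertexExpansion311

open MeasureTheory Matrix Finset Filter
open scoped BigOperators
open Literature.MathematicalPhysics.QuantumFieldTheory.Balaban1983to89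
open B2Eq228Conditioning (weight source)
open BIJ88VertexIbp311 (lmono lmono_nil lmono_cons vexp continuous_vexp ibp_step)

variable {S : Type} [Fintype S]


/-! ## §3  The expansion: its terms, their kinds and vertex counts -/

section Terms

variable {ι : Type} [Fintype ι]

/-- **Why a term of the expansion is terminal** (p. 311): `const` — *"the term is constant (all legs contracted)"* with
no contraction to `χ′` and at most `m̄` vertices; `dchi z` — *"a contraction to χ′_{Λ^{(k)}} occurs"* (the weight carries
`∂_zχ`, `z = Cu`, in place of `χ`); `cap` — *"at least m̄+1 interactions have been differentiated down"*.
[cite: BalabanImbrieJaffe1988, §5.14 p.311] -/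
inductive Kind (S : Type) : Type
  | const : Kind S
  | dchi (z : S → ℝ) : Kind S
  | cap : Kind S

/-- **A term of the integration-by-parts expansion**: a numerical coefficient (product of the contraction weights), the
pending (uncontracted) legs, the reason it is terminal, and the number of interaction vertices differentiated down in
it. [cite: BalabanImbrieJaffe1988, §5.14 p.311] -/
structure Term (S : Type) : Type where
  /-- product of the contraction weights `⟨Cu,v⟩`, `⟨Cu,ℱ⟩`, `−c_m⟨Cu,(legs m)_j⟩` along the history -/
  coef : ℝ
  /-- the legs not (yet) contracted: the observable `F_{k,rem}` of a remainder term -/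
  pend : List (S → ℝ)
  /-- why the term is terminal -/
  kind : Kind S
  /-- number of interaction vertices differentiated down -/
  nv : ℕ

/-- Multiply the coefficient of a term by a contraction weight. [cite: BalabanImbrieJaffe1988, §5.14 p.311] -/
def Term.scale (a : ℝ) (t : Term S) : Term S := ⟨a * t.coef, t.pend, t.kind, t.nv⟩

/-- One more vertex in the history of a term. [cite: BalabanImbrieJaffe1988, §5.14 p.311] -/
def Term.bump (t : Term S) : Term S := ⟨t.coef, t.pend, t.kind, t.nv + 1⟩

omit [Fintype S] in
/-- Scaling multiplies the coefficient. [cite: BalabanImbrieJaffe1988, §5.14 p.311] -/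
@[simp] theorem Term.scale_coef (a : ℝ) (t : Term S) : (t.scale a).coef = a * t.coef := rfl
omit [Fintype S] in
/-- Scaling keeps the pending legs. [cite: BalabanImbrieJaffe1988, §5.14 p.311] -/
@[simp] theorem Term.scale_pend (a : ℝ) (t : Term S) : (t.scale a).pend = t.pend := rfl
omit [Fintype S] in
/-- Scaling keeps the kind. [cite: BalabanImbrieJaffe1988, §5.14 p.311] -/
@[simp] theorem Term.scale_kind (a : ℝ) (t : Term S) : (t.scale a).kind = t.kind := rfl
omit [Fintype S] in
/-- Scaling keeps the vertex count. [cite: BalabanImbrieJaffe1988, §5.14 p.311] -/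
@[simp] theorem Term.scale_nv (a : ℝ) (t : Term S) : (t.scale a).nv = t.nv := rfl
omit [Fintype S] in
/-- A further vertex keeps the coefficient. [cite: BalabanImbrieJaffe1988, §5.14 p.311] -/
@[simp] theorem Term.bump_coef (t : Term S) : t.bump.coef = t.coef := rfl
omit [Fintype S] in
/-- A further vertex keeps the pending legs. [cite: BalabanImbrieJaffe1988, §5.14 p.311] -/
@[simp] theorem Term.bump_pend (t : Term S) : t.bump.pend = t.pend := rfl
omit [Fintype S] in
/-- A further vertex keeps the kind. [cite: BalabanImbrieJaffe1988, §5.14 p.311] -/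
@[simp] theorem Term.bump_kind (t : Term S) : t.bump.kind = t.kind := rfl
omit [Fintype S] in
/-- A further vertex raises the vertex count by one. [cite: BalabanImbrieJaffe1988, §5.14 p.311] -/
@[simp] theorem Term.bump_nv (t : Term S) : t.bump.nv = t.nv + 1 := rfl

variable [DecidableEq S]

/-- **THE INTEGRATION BY PARTS EXPANSION WITH PRINT'S STOPPING RULE** (p. 311, one component): the list of terminal terms
obtained from the pending legs `L` (head first) with a remaining budget of `b` further vertices before completeness
(`b = m̄ −` the number of vertices already differentiated down).  The head field `Φ(u)` is integrated by parts
(`ibp_step`): it contracts to another pending leg `L_i` (weight `⟨Cu,L_i⟩`, continue with `L∖i`), to the source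
(`⟨Cu,ℱ⟩`, continue with `L`), to `χ′` (TERMINAL, kind `dchi (Cu)`, the other legs stay pending), or to the vertex `m`
through its leg `j` (weight `−c_m⟨Cu,(legs m)_j⟩`; the other legs of the vertex are appended to the pending legs and
the expansion CONTINUES with budget `b−1` — unless the budget is exhausted, `b = 0`: this is the `(m̄+1)`-th vertex and
the term is TERMINAL of kind `cap`); no pending leg left: TERMINAL of kind `const` (*"We stop integrating by parts fields
in complete components"*). Well-founded on `(b, |L|)`. [cite: BalabanImbrieJaffe1988, §5.14 p.311] -/
def terms (A : Matrix S S ℝ) (f : S → ℝ) (c : ι → ℝ) (legs : ι → List (S → ℝ)) :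
    List (S → ℝ) → ℕ → List (Term S)
  | [], _ => [⟨1, [], .const, 0⟩]
  | u :: L, 0 =>
      ((range L.length).toList.flatMap fun i =>
          (terms A f c legs (L.eraseIdx i) 0).map (Term.scale ((A⁻¹ *ᵥ u) ⬝ᵥ L.getD i 0)))
      ++ (terms A f c legs L 0).map (Term.scale ((A⁻¹ *ᵥ u) ⬝ᵥ f))
      ++ [⟨1, L, .dchi (A⁻¹ *ᵥ u), 0⟩]
      ++ ((univ : Finset ι).toList.flatMap fun m => (range (legs m).length).toList.flatMap fun j =>
          [(⟨-(c m * ((A⁻¹ *ᵥ u) ⬝ᵥ (legs m).getD j 0)), L ++ (legs m).eraseIdx j, .cap, 1⟩ : Term S)])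
  | u :: L, b + 1 =>
      ((range L.length).toList.flatMap fun i =>
          (terms A f c legs (L.eraseIdx i) (b + 1)).map (Term.scale ((A⁻¹ *ᵥ u) ⬝ᵥ L.getD i 0)))
      ++ (terms A f c legs L (b + 1)).map (Term.scale ((A⁻¹ *ᵥ u) ⬝ᵥ f))
      ++ [⟨1, L, .dchi (A⁻¹ *ᵥ u), 0⟩]
      ++ ((univ : Finset ι).toList.flatMap fun m => (range (legs m).length).toList.flatMap fun j =>
          (terms A f c legs (L ++ (legs m).eraseIdx j) b).map fun t =>
            (t.scale (-(c m * ((A⁻¹ *ᵥ u) ⬝ᵥ (legs m).getD j 0)))).bump)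
  termination_by L b => (b, L.length)
  decreasing_by
    all_goals first
      | exact Prod.Lex.left _ _ (Nat.lt_succ_self _)
      | (apply Prod.Lex.right; simp only [List.length_eraseIdx, List.length_cons]; split <;> omega)
      | (apply Prod.Lex.right; simp only [List.length_cons]; omega)

/-- **What the stopping rule guarantees about each term** (p. 311 classification): a `const` term has no pending leg
(*"all legs contracted"*); a `cap` term has exactly `b+1` vertices (*"at least m̄+1 interactions have been differentiated
down"*, with `b = m̄`); every other term has at most `b` vertices. [cite: BalabanImbrieJaffe1988, §5.14 p.311] -/
theorem terms_sound (A : Matrix S S ℝ) (f : S → ℝ) (c : ι → ℝ) (legs : ι → List (S → ℝ)) :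
    ∀ (L : List (S → ℝ)) (b : ℕ), ∀ t ∈ terms A f c legs L b,
      (t.kind = Kind.const → t.pend = []) ∧ (t.kind = Kind.cap → t.nv = b + 1) ∧ (t.kind ≠ Kind.cap → t.nv ≤ b)
  | [], b => by
    intro t ht
    rw [terms, List.mem_singleton] at ht
    subst ht
    exact ⟨fun _ => rfl, fun h => (by cases h), fun _ => Nat.zero_le _⟩
  | u :: L, 0 => by
    intro t ht
    rw [terms] at ht
    simp only [List.mem_append, List.mem_flatMap, List.mem_map, Finset.mem_toList, List.mem_singleton] at ht
    rcases ht with ((⟨i, -, t', ht', rfl⟩ | ⟨t', ht', rfl⟩) | rfl) | ⟨m, -, j, -, rfl⟩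
    · simpa only [Term.scale_kind, Term.scale_pend, Term.scale_nv] using terms_sound A f c legs (L.eraseIdx i) 0 t' ht'
    · simpa only [Term.scale_kind, Term.scale_pend, Term.scale_nv] using terms_sound A f c legs L 0 t' ht'
    · exact ⟨fun h => (by cases h), fun h => (by cases h), fun _ => le_rfl⟩
    · exact ⟨fun h => (by cases h), fun _ => rfl, fun h => absurd rfl h⟩
  | u :: L, b + 1 => by
    intro t ht
    rw [terms] at ht
    simp only [List.mem_append, List.mem_flatMap, List.mem_map, Finset.mem_toList, List.mem_singleton] at ht
    rcases ht with ((⟨i, -, t', ht', rfl⟩ | ⟨t', ht', rfl⟩) | rfl) | ⟨m, -, j, -, t', ht', rfl⟩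
    · simpa only [Term.scale_kind, Term.scale_pend, Term.scale_nv] using
        terms_sound A f c legs (L.eraseIdx i) (b + 1) t' ht'
    · simpa only [Term.scale_kind, Term.scale_pend, Term.scale_nv] using terms_sound A f c legs L (b + 1) t' ht'
    · exact ⟨fun h => (by cases h), fun h => (by cases h), fun _ => Nat.zero_le _⟩
    · obtain ⟨h₁, h₂, h₃⟩ := terms_sound A f c legs (L ++ (legs m).eraseIdx j) b t' ht'
      refine ⟨fun h => h₁ h, fun h => ?_, fun h => ?_⟩
      · simp only [Term.bump_nv, Term.scale_nv, h₂ h]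
      · have := h₃ h
        simp only [Term.bump_nv, Term.scale_nv]
        omega
  termination_by L b => (b, L.length)
  decreasing_by
    all_goals first
      | exact Prod.Lex.left _ _ (Nat.lt_succ_self _)
      | (apply Prod.Lex.right; simp only [List.length_eraseIdx, List.length_cons]; split <;> omega)
      | (apply Prod.Lex.right; simp only [List.length_cons]; omega)

end Terms

/-! ## §4  The identity: every term accounted for -/

section Identity

variable {ι : Type} [Fintype ι]

/-- The cutoff factor a terminal term carries: `χ` itself, or `∂_zχ` after *"a contraction to χ′"*.
[cite: BalabanImbrieJaffe1988, §5.14 p.311] -/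
def kfac (χ : (S → ℝ) → ℝ) : Kind S → (S → ℝ) → ℝ
  | .const => χ
  | .dchi z => fun φ => fderiv ℝ χ φ z
  | .cap => χ

omit [Fintype S] in
/-- A constant term carries `χ`. [cite: BalabanImbrieJaffe1988, §5.14 p.311] -/
@[simp] theorem kfac_const (χ : (S → ℝ) → ℝ) : kfac χ Kind.const = χ := rfl
omit [Fintype S] in
/-- A `cap` term carries `χ`. [cite: BalabanImbrieJaffe1988, §5.14 p.311] -/
@[simp] theorem kfac_cap (χ : (S → ℝ) → ℝ) : kfac χ Kind.cap = χ := rfl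
omit [Fintype S] in
/-- A `χ′`-term carries `∂_zχ` (*"a contraction to χ′ occurs"*). [cite: BalabanImbrieJaffe1988, §5.14 p.311] -/
@[simp] theorem kfac_dchi (χ : (S → ℝ) → ℝ) (z : S → ℝ) : kfac χ (Kind.dchi z) = fun φ => fderiv ℝ χ φ z := rfl

/-- **The value of a term**: its coefficient times the Gaussian integral of its pending monomial against its cutoff
factor and `e^{−V}` — for a remainder term the (unnormalized) expectation of its observable `F_{k,rem}`, for a constant
term its coefficient times `∫χe^{−V}dμ`. [cite: BalabanImbrieJaffe1988, §5.14 p.311–312] -/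
def tint (A : Matrix S S ℝ) (f : S → ℝ) (χ : (S → ℝ) → ℝ) (c : ι → ℝ) (legs : ι → List (S → ℝ)) (t : Term S) : ℝ :=
  t.coef * ∫ φ : S → ℝ, lmono t.pend φ * (kfac χ t.kind φ * vexp c legs φ) * (weight A φ * source f φ)

variable (A : Matrix S S ℝ) (f : S → ℝ) (χ : (S → ℝ) → ℝ) (c : ι → ℝ) (legs : ι → List (S → ℝ))

/-- The value of a scaled term. [cite: BalabanImbrieJaffe1988, §5.14 p.311] -/
theorem tint_scale (a : ℝ) (t : Term S) : tint A f χ c legs (t.scale a) = a * tint A f χ c legs t := by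
  simp only [tint, Term.scale, mul_assoc]

/-- The value of a term does not depend on its vertex count. [cite: BalabanImbrieJaffe1988, §5.14 p.311] -/
theorem tint_bump (t : Term S) : tint A f χ c legs t.bump = tint A f χ c legs t := rfl

omit [Fintype S] [Fintype ι] in
/-- Sums over a `flatMap` are iterated sums. [folklore] -/
private theorem sum_map_flatMap {α β : Type} (l : List α) (g : α → List β) (h : β → ℝ) :
    ((l.flatMap g).map h).sum = (l.map fun a => ((g a).map h).sum).sum := by
  induction l with
  | nil => simp
  | cons a l ih => simp [List.flatMap_cons, List.map_append, List.sum_append, ih]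

/-- Total value of a list of scaled terms. [cite: BalabanImbrieJaffe1988, §5.14 p.311] -/
theorem sum_tint_scale (a : ℝ) : ∀ ts : List (Term S),
    ((ts.map (Term.scale a)).map (tint A f χ c legs)).sum = a * (ts.map (tint A f χ c legs)).sum
  | [] => by simp
  | t :: ts => by
    simp only [List.map_cons, List.sum_cons, tint_scale, sum_tint_scale a ts, mul_add]

/-- Total value of a list of scaled terms with one more vertex. [cite: BalabanImbrieJaffe1988, §5.14 p.311] -/
theorem sum_tint_scale_bump (a : ℝ) : ∀ ts : List (Term S),
    ((ts.map fun t => (t.scale a).bump).map (tint A f χ c legs)).sum = a * (ts.map (tint A f χ c legs)).sum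
  | [] => by simp
  | t :: ts => by
    simp only [List.map_cons, List.sum_cons, tint_bump, tint_scale, sum_tint_scale_bump a ts, mul_add]

variable {A f χ c legs} [DecidableEq S]

/-- **THE EXPANSION IDENTITY** — every field integrated by parts until its term is complete, nothing lost:
`∫ Π_L Φ · χe^{−V} dμ = Σ_{t ∈ terms L b} coef_t · ∫ Π_{pend t}Φ · (χ | ∂_zχ) e^{−V} dμ` for EVERY budget `b`.
Hypotheses: `A` positive definite, `χ ∈ C¹`, `χe^{−V}` bounded, `(∂_zχ)e^{−V}` bounded for every direction `z`.
[cite: BalabanImbrieJaffe1988, §5.14 p.311–312] [cite: GlimmJaffe1987, §9.1 (9.1.32)] -/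
theorem expansion (hA : A.PosDef) (hχ : ContDiff ℝ 1 χ) {K₀ : ℝ} (h0 : ∀ φ, ‖χ φ * vexp c legs φ‖ ≤ K₀)
    (h1 : ∀ z, ∃ K, ∀ φ, ‖fderiv ℝ χ φ z * vexp c legs φ‖ ≤ K) :
    ∀ (L : List (S → ℝ)) (b : ℕ),
      ∫ φ : S → ℝ, lmono L φ * (χ φ * vexp c legs φ) * (weight A φ * source f φ)
        = ((terms A f c legs L b).map (tint A f χ c legs)).sum
  | [], b => by simp [terms, tint]
  | u :: L, 0 => by
    obtain ⟨K₁, hK₁⟩ := h1 (A⁻¹ *ᵥ u)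
    rw [ibp_step A hA f c legs hχ h0 u hK₁ L, terms]
    simp only [List.map_append, List.sum_append, List.map_cons, List.map_nil, List.sum_cons, List.sum_nil,
      add_zero, sum_map_flatMap, sum_tint_scale, Finset.sum_map_toList]
    have hP : ∀ i ∈ range L.length, ((A⁻¹ *ᵥ u) ⬝ᵥ L.getD i 0) *
          ((terms A f c legs (L.eraseIdx i) 0).map (tint A f χ c legs)).sum
        = ((A⁻¹ *ᵥ u) ⬝ᵥ L.getD i 0) *
          ∫ φ : S → ℝ, lmono (L.eraseIdx i) φ * (χ φ * vexp c legs φ) * (weight A φ * source f φ) :=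
      fun i _ => by rw [expansion hA hχ h0 h1 (L.eraseIdx i) 0]
    rw [sum_congr rfl hP, ← expansion hA hχ h0 h1 L 0]
    simp only [tint, kfac_dchi, kfac_cap, one_mul]
  | u :: L, b + 1 => by
    obtain ⟨K₁, hK₁⟩ := h1 (A⁻¹ *ᵥ u)
    rw [ibp_step A hA f c legs hχ h0 u hK₁ L, terms]
    simp only [List.map_append, List.sum_append, List.map_cons, List.map_nil, List.sum_cons, List.sum_nil,
      add_zero, sum_map_flatMap, sum_tint_scale, sum_tint_scale_bump, Finset.sum_map_toList]
    have hP : ∀ i ∈ range L.length, ((A⁻¹ *ᵥ u) ⬝ᵥ L.getD i 0) *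
          ((terms A f c legs (L.eraseIdx i) (b + 1)).map (tint A f χ c legs)).sum
        = ((A⁻¹ *ᵥ u) ⬝ᵥ L.getD i 0) *
          ∫ φ : S → ℝ, lmono (L.eraseIdx i) φ * (χ φ * vexp c legs φ) * (weight A φ * source f φ) :=
      fun i _ => by rw [expansion hA hχ h0 h1 (L.eraseIdx i) (b + 1)]
    have hW : ∀ m ∈ (univ : Finset ι), ∑ j ∈ range (legs m).length,
          (-(c m * ((A⁻¹ *ᵥ u) ⬝ᵥ (legs m).getD j 0))) *
            ((terms A f c legs (L ++ (legs m).eraseIdx j) b).map (tint A f χ c legs)).sum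
        = ∑ j ∈ range (legs m).length, (-(c m * ((A⁻¹ *ᵥ u) ⬝ᵥ (legs m).getD j 0))) *
            ∫ φ : S → ℝ, lmono (L ++ (legs m).eraseIdx j) φ * (χ φ * vexp c legs φ) *
              (weight A φ * source f φ) :=
      fun m _ => sum_congr rfl fun j _ => by rw [expansion hA hχ h0 h1 (L ++ (legs m).eraseIdx j) b]
    rw [sum_congr rfl hP, ← expansion hA hχ h0 h1 L (b + 1), sum_congr rfl hW]
    simp only [tint, kfac_dchi, one_mul]
  termination_by L b => (b, L.length)
  decreasing_by
    all_goals first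
      | exact Prod.Lex.left _ _ (Nat.lt_succ_self _)
      | (apply Prod.Lex.right; simp only [List.length_eraseIdx, List.length_cons]; split <;> omega)
      | (apply Prod.Lex.right; simp only [List.length_cons]; omega)

/-- **`F^L` — the constant part**: the total coefficient of the constant terms, i.e. the sum of ALL complete contraction
diagrams of the legs `L` with at most `b` interaction vertices differentiated down and no contraction to `χ′` (*"Summing
all possible diagrams in X_c gives the observable for the next step there, F^L_{k+1,loc}(X_c)"*).
[cite: BalabanImbrieJaffe1988, §5.14 p.312] -/
def cst (A : Matrix S S ℝ) (f : S → ℝ) (c : ι → ℝ) (legs : ι → List (S → ℝ)) (L : List (S → ℝ)) (b : ℕ) : ℝ :=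
  ((terms A f c legs L b).map fun t => match t.kind with | .const => t.coef | _ => 0).sum

/-- **The remainder part**: the total value of the remainder terms — those carrying a `χ′` or exactly `b+1` vertices,
each the coefficient times the unnormalized expectation of its pending observable (*"Summing all terms in X_r gives an
observable F_{k,rem}(X_r)"*). [cite: BalabanImbrieJaffe1988, §5.14 p.312] -/
def remv (A : Matrix S S ℝ) (f : S → ℝ) (χ : (S → ℝ) → ℝ) (c : ι → ℝ) (legs : ι → List (S → ℝ))
    (L : List (S → ℝ)) (b : ℕ) : ℝ :=
  ((terms A f c legs L b).map fun t => match t.kind with | .const => 0 | _ => tint A f χ c legs t).sum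

/-- **CONSTANT PART PLUS REMAINDER**: `∫ Π_LΦ · χe^{−V}dμ = F^L · ∫χe^{−V}dμ + Σ_{remainder terms}` — a constant term has no
pending leg (`terms_sound`), so its value is its coefficient times the normalization `∫χe^{−V}dμ`.
[cite: BalabanImbrieJaffe1988, §5.14 p.312] -/
theorem expansion_split (hA : A.PosDef) (hχ : ContDiff ℝ 1 χ) {K₀ : ℝ} (h0 : ∀ φ, ‖χ φ * vexp c legs φ‖ ≤ K₀)
    (h1 : ∀ z, ∃ K, ∀ φ, ‖fderiv ℝ χ φ z * vexp c legs φ‖ ≤ K) (L : List (S → ℝ)) (b : ℕ) :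
    ∫ φ : S → ℝ, lmono L φ * (χ φ * vexp c legs φ) * (weight A φ * source f φ)
      = cst A f c legs L b * (∫ φ : S → ℝ, χ φ * vexp c legs φ * (weight A φ * source f φ))
        + remv A f χ c legs L b := by
  rw [expansion hA hχ h0 h1 L b, cst, remv, ← List.sum_map_mul_right, ← List.sum_map_add]
  congr 1
  refine List.map_congr_left fun t ht => ?_
  obtain ⟨hc, -, -⟩ := terms_sound A f c legs L b t ht
  rcases hk : t.kind with _ | z | _
  · simp only [tint, hk, hc hk, lmono_nil, kfac_const, one_mul, add_zero]
  · simp only [zero_mul, zero_add]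
  · simp only [zero_mul, zero_add]

/-- **THE p. 312 DISPLAY FOR ONE COMPONENT** — *"Then the result of the integration by parts is
⟨Π_{σ_i} F^{m̄}_{k,loc}(X_{σ_i})⟩ = Σ Π_c F^L_{k+1,loc}(X_c) ⟨Π_r F_{k,rem}(X_r)⟩"*: in the expectation of the measure
carrying the weight `χe^{−V}`, the monomial observable `Π_LΦ` equals its constant part `F^L` (all diagrams with at
most `b = m̄` vertices) plus the normalized remainder terms (each with a `χ′` or exactly `m̄+1` vertices).
[cite: BalabanImbrieJaffe1988, §5.14 p.312] -/
theorem expansion_display (hA : A.PosDef) (hχ : ContDiff ℝ 1 χ) {K₀ : ℝ} (h0 : ∀ φ, ‖χ φ * vexp c legs φ‖ ≤ K₀)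
    (h1 : ∀ z, ∃ K, ∀ φ, ‖fderiv ℝ χ φ z * vexp c legs φ‖ ≤ K)
    (hZ : ∫ φ : S → ℝ, χ φ * vexp c legs φ * (weight A φ * source f φ) ≠ 0) (L : List (S → ℝ)) (b : ℕ) :
    (∫ φ : S → ℝ, lmono L φ * (χ φ * vexp c legs φ) * (weight A φ * source f φ))
        / (∫ φ : S → ℝ, χ φ * vexp c legs φ * (weight A φ * source f φ))
      = cst A f c legs L b
        + remv A f χ c legs L b / ∫ φ : S → ℝ, χ φ * vexp c legs φ * (weight A φ * source f φ) := by
  rw [expansion_split hA hχ h0 h1 L b, add_div, mul_div_cancel_right₀ _ hZ]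

omit [DecidableEq S] in
/-- **The hypotheses hold for a compactly supported `C¹` cutoff** (small-field characteristic functions restricting
every integrated field): `χe^{−V}` and every `(∂_zχ)e^{−V}` are bounded, whatever the polynomial `V`.
[folklore] [cite: BalabanImbrieJaffe1988, (5.14.1) p.308] -/
theorem bounds_of_hasCompactSupport (c : ι → ℝ) (legs : ι → List (S → ℝ)) {χ : (S → ℝ) → ℝ}
    (hχ : ContDiff ℝ 1 χ) (hs : HasCompactSupport χ) :
    (∃ K₀, ∀ φ, ‖χ φ * vexp c legs φ‖ ≤ K₀) ∧ (∀ z, ∃ K, ∀ φ, ‖fderiv ℝ χ φ z * vexp c legs φ‖ ≤ K) := by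
  refine ⟨?_, fun z => ?_⟩
  · have hc : Continuous fun φ => χ φ * vexp c legs φ := hχ.continuous.mul (continuous_vexp c legs)
    exact hc.bounded_above_of_compact_support (hs.mul_right (f' := vexp c legs))
  · have hc : Continuous fun φ => fderiv ℝ χ φ z * vexp c legs φ :=
      ((hχ.continuous_fderiv one_ne_zero).clm_apply continuous_const).mul (continuous_vexp c legs)
    exact hc.bounded_above_of_compact_support ((hs.fderiv_apply (𝕜 := ℝ) z).mul_right (f' := vexp c legs))

/-! ## §5  The small factor per vertex: coefficient bounds -/

omit [Fintype S] [DecidableEq S] in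
/-- Pending legs stay inside a set of directions containing the original legs and all vertex legs. [folklore] -/
private theorem subset_of_eraseIdx {Dir : Set (S → ℝ)} {L : List (S → ℝ)} (hL : ∀ w ∈ L, w ∈ Dir) (i : ℕ) :
    ∀ w ∈ L.eraseIdx i, w ∈ Dir := fun w hw => hL w (List.mem_of_mem_eraseIdx hw)

omit [Fintype S] [DecidableEq S] in
/-- An in-range default access is a member. [folklore] -/
private theorem getD_mem_of_lt {Dir : Set (S → ℝ)} {L : List (S → ℝ)} (hL : ∀ w ∈ L, w ∈ Dir) {i : ℕ} (hi : i < L.length) :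
    L.getD i 0 ∈ Dir := by
  rw [List.getD_eq_getElem _ _ hi]
  exact hL _ (List.getElem_mem hi)

/-- One contraction weight times a bounded coefficient: `|a·x| ≤ M^{N'+1}·y` from `|a| ≤ B ≤ M`, `|x| ≤ M^{N'}·y`.
[folklore] -/
private theorem abs_mul_le_step {a x B M y : ℝ} {N' N : ℕ} (ha : |a| ≤ B) (hBM : B ≤ M) (hM : 1 ≤ M) (hy : 0 ≤ y)
    (hx : |x| ≤ M ^ N' * y) (hN : N' + 1 ≤ N) : |a * x| ≤ M ^ N * y := by
  have hX : 0 ≤ M ^ N' * y := mul_nonneg (pow_nonneg (zero_le_one.trans hM) _) hy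
  rw [abs_mul]
  calc |a| * |x| ≤ B * (M ^ N' * y) := mul_le_mul ha hx (abs_nonneg _) ((abs_nonneg a).trans ha)
    _ ≤ M * (M ^ N' * y) := mul_le_mul_of_nonneg_right hBM hX
    _ = M ^ (N' + 1) * y := by ring
    _ ≤ M ^ N * y := mul_le_mul_of_nonneg_right (pow_le_pow_right₀ hM hN) hy

/-- **EACH DIFFERENTIATED-DOWN VERTEX CONTRIBUTES ONE COUPLING CONSTANT** (p. 312 *"By performing sufficiently many
integrations by parts, we have arranged for enough small factors to beat these large factors in the remainder terms"*):
if every covariance bracket `⟨Cu,v⟩`, `⟨Cu,ℱ⟩` between the directions in play (a set `Dir` containing the legs and all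
vertex legs) is bounded by `B`, and every vertex coefficient by `|c_m| ≤ c_M`, then every term of `terms L b` has
`|coef| ≤ (max B 1)^{|L|+1+b·D} · c_M^{nv}` (`D` ≥ the number of legs of every vertex) — in particular a `cap` term
(exactly `b+1 = m̄+1` vertices, `terms_sound`) carries the small factor `c_M^{m̄+1}`.
[cite: BalabanImbrieJaffe1988, §5.14 p.312] -/
theorem coef_bound (A : Matrix S S ℝ) (f : S → ℝ) (c : ι → ℝ) (legs : ι → List (S → ℝ)) {Dir : Set (S → ℝ)}
    {B cM : ℝ} (hB : ∀ u ∈ Dir, ∀ v ∈ Dir, |(A⁻¹ *ᵥ u) ⬝ᵥ v| ≤ B) (hBf : ∀ u ∈ Dir, |(A⁻¹ *ᵥ u) ⬝ᵥ f| ≤ B)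
    (hcM : 0 ≤ cM) (hc : ∀ m, |c m| ≤ cM) (hlegs : ∀ m, ∀ w ∈ legs m, w ∈ Dir) {D : ℕ}
    (hD : ∀ m, (legs m).length ≤ D) :
    ∀ (L : List (S → ℝ)) (b : ℕ), (∀ w ∈ L, w ∈ Dir) → ∀ t ∈ terms A f c legs L b,
      |t.coef| ≤ (max B 1) ^ (L.length + 1 + b * D) * cM ^ t.nv
  | [], b, _ => by
    intro t ht
    rw [terms, List.mem_singleton] at ht
    subst ht
    simp only [abs_one, List.length_nil, pow_zero, mul_one]
    exact one_le_pow₀ (le_max_right B 1)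
  | u :: L, 0, hL => by
    intro t ht
    have hu : u ∈ Dir := hL u List.mem_cons_self
    have hL' : ∀ w ∈ L, w ∈ Dir := fun w hw => hL w (List.mem_cons_of_mem u hw)
    have hM : 1 ≤ max B 1 := le_max_right B 1
    have hBM : B ≤ max B 1 := le_max_left B 1
    rw [terms] at ht
    simp only [List.mem_append, List.mem_flatMap, List.mem_map, Finset.mem_toList, Finset.mem_range,
      List.mem_singleton] at ht
    rcases ht with ((⟨i, hi, t', ht', rfl⟩ | ⟨t', ht', rfl⟩) | rfl) | ⟨m, -, j, hj, rfl⟩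
    · rw [Term.scale_coef, Term.scale_nv]
      refine abs_mul_le_step (hB u hu _ (getD_mem_of_lt hL' hi)) hBM hM (pow_nonneg hcM _)
        (coef_bound A f c legs hB hBf hcM hc hlegs hD (L.eraseIdx i) 0 (subset_of_eraseIdx hL' i) t' ht') ?_
      have := List.length_eraseIdx_le L i
      simp only [List.length_cons]
      omega
    · rw [Term.scale_coef, Term.scale_nv]
      refine abs_mul_le_step (hBf u hu) hBM hM (pow_nonneg hcM _)
        (coef_bound A f c legs hB hBf hcM hc hlegs hD L 0 hL' t' ht') ?_
      simp only [List.length_cons]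
      omega
    · simp only [abs_one, pow_zero, mul_one]
      exact one_le_pow₀ hM
    · simp only [pow_one, abs_neg, abs_mul]
      have ha : |(A⁻¹ *ᵥ u) ⬝ᵥ (legs m).getD j 0| ≤ B := hB u hu _ (getD_mem_of_lt (hlegs m) hj)
      calc |c m| * |(A⁻¹ *ᵥ u) ⬝ᵥ (legs m).getD j 0| ≤ cM * max B 1 :=
            mul_le_mul (hc m) (ha.trans hBM) (abs_nonneg _) hcM
        _ = (max B 1) ^ 1 * cM := by ring
        _ ≤ (max B 1) ^ ((u :: L).length + 1 + 0 * D) * cM :=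
            mul_le_mul_of_nonneg_right (pow_le_pow_right₀ hM (by simp)) hcM
  | u :: L, b + 1, hL => by
    intro t ht
    have hu : u ∈ Dir := hL u List.mem_cons_self
    have hL' : ∀ w ∈ L, w ∈ Dir := fun w hw => hL w (List.mem_cons_of_mem u hw)
    have hM : 1 ≤ max B 1 := le_max_right B 1
    have hBM : B ≤ max B 1 := le_max_left B 1
    rw [terms] at ht
    simp only [List.mem_append, List.mem_flatMap, List.mem_map, Finset.mem_toList, Finset.mem_range,
      List.mem_singleton] at ht
    rcases ht with ((⟨i, hi, t', ht', rfl⟩ | ⟨t', ht', rfl⟩) | rfl) | ⟨m, -, j, hj, t', ht', rfl⟩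
    · rw [Term.scale_coef, Term.scale_nv]
      refine abs_mul_le_step (hB u hu _ (getD_mem_of_lt hL' hi)) hBM hM (pow_nonneg hcM _)
        (coef_bound A f c legs hB hBf hcM hc hlegs hD (L.eraseIdx i) (b + 1) (subset_of_eraseIdx hL' i) t' ht') ?_
      have := List.length_eraseIdx_le L i
      simp only [List.length_cons]
      omega
    · rw [Term.scale_coef, Term.scale_nv]
      refine abs_mul_le_step (hBf u hu) hBM hM (pow_nonneg hcM _)
        (coef_bound A f c legs hB hBf hcM hc hlegs hD L (b + 1) hL' t' ht') ?_
      simp only [List.length_cons]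
      omega
    · simp only [abs_one, pow_zero, mul_one]
      exact one_le_pow₀ hM
    · have hLm : ∀ w ∈ L ++ (legs m).eraseIdx j, w ∈ Dir := fun w hw => by
        rcases List.mem_append.1 hw with h | h
        · exact hL' w h
        · exact hlegs m w (List.mem_of_mem_eraseIdx h)
      have IH := coef_bound A f c legs hB hBf hcM hc hlegs hD (L ++ (legs m).eraseIdx j) b hLm t' ht'
      have ha : |(A⁻¹ *ᵥ u) ⬝ᵥ (legs m).getD j 0| ≤ B := hB u hu _ (getD_mem_of_lt (hlegs m) hj)
      rw [Term.bump_coef, Term.scale_coef, Term.bump_nv, Term.scale_nv, pow_succ, ← mul_assoc, neg_mul, abs_neg,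
        mul_assoc, abs_mul]
      have hstep : |(A⁻¹ *ᵥ u) ⬝ᵥ (legs m).getD j 0 * t'.coef|
          ≤ (max B 1) ^ ((u :: L).length + 1 + (b + 1) * D) * cM ^ t'.nv := by
        refine abs_mul_le_step ha hBM hM (pow_nonneg hcM _) IH ?_
        have h1 := List.length_eraseIdx_le (legs m) j
        have h2 := hD m
        simp only [List.length_cons, List.length_append, Nat.succ_mul]
        omega
      calc |c m| * |(A⁻¹ *ᵥ u) ⬝ᵥ (legs m).getD j 0 * t'.coef|
          ≤ cM * ((max B 1) ^ ((u :: L).length + 1 + (b + 1) * D) * cM ^ t'.nv) :=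
            mul_le_mul (hc m) hstep (abs_nonneg _) hcM
        _ = (max B 1) ^ ((u :: L).length + 1 + (b + 1) * D) * cM ^ t'.nv * cM := by ring
  termination_by L b => (b, L.length)
  decreasing_by
    all_goals first
      | exact Prod.Lex.left _ _ (Nat.lt_succ_self _)
      | (apply Prod.Lex.right; simp only [List.length_eraseIdx, List.length_cons]; split <;> omega)
      | (apply Prod.Lex.right; simp only [List.length_cons]; omega)

end Identity


end Literature.MathematicalPhysics.QuantumFieldTheory.BalabanImbrieJaffe1984to88.BIJ88VertexExpansion311
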